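import Summits.Ventures.PercRepro.Night2FatZThreeB
import Summits.Ventures.PercRepro.Night2FatDegSingle

/-!
# night-2: the witnesses of the singly degenerate regime at small `N` — side points, free points, unloaded singletons — the preamble facts, part 2

**`exists_small_witnesses_deg`**: for every lossy basis pair of the singly degenerate regime there are sets `U` of side
points, `V` of free points and `E` of points on no non-class basis line (unloaded singletons) of `W ∖ {x}` in one of
four patterns: (α) the line of `M` is not a non-class basis line, `|U| = 2`, `|V| = 1`, `|E| ≥ 2`;
(β) `|U| = 1`, `|V| = 3`, `|E| ≥ 2`; (γ) `|U| = 2`, `|V| = 2`, `|E| ≥ 1`; (δ) `|U| = 1`, `|V| = 2`, `|E| ≥ 3`.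
Each pattern gives the fair share at `N = 6, 7, 8` (`Night2FatDegNumIccA/B`).  The case analysis follows
`exists_side_and_free_deg`: `|P₂| ∈ {0, 1, 2, 3}` basis points of `π₂` off the spine.
Paper `proofs/NIGHT-2-g35.md` §5.
-/

namespace PercRepro.Shadow

open PercRepro.ThmH PercRepro.PerFlat

variable {α : Type*} [DecidableEq α] {M : Matroid α} [M.Finite] {G : Finset α}

/-- A point of `π₂` off the spine in `W` is free under the pencil condition. -/
theorem deg_wit_freeA {w₀ x : α} {R₁ : Finset α} {c₂ c₃ : α} {B : Finset α} {z : α} (hd : (gr M \ G).card = 2)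
    (hk : kColoops M G = 1) (hs : ∀ e ∈ gr M, ∀ f ∈ gr M, e ≠ f → rkN M {e, f} = 2)
    (hfat : (fatClosures M 5 G 2).card ≤ 1) (hR₁V : R₁ ⊆ (G \ coloops M G) \ {w₀, x}) (hR₁2 : rkN M R₁ = 2)
    (hR₁3 : 3 ≤ R₁.card) (hcop : rkN M (insert w₀ (insert x R₁)) ≤ 3) (hc₂V : c₂ ∈ (G \ coloops M G) \ {w₀, x})
    (hc₃V : c₃ ∈ (G \ coloops M G) \ {w₀, x}) (hc₂ : c₂ ∉ clF M R₁) (hc₃ : c₃ ∉ clF M (insert c₂ R₁))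
    (hcover : ∀ e ∈ (G \ coloops M G) \ {w₀, x}, e ∈ clF M (insert c₂ R₁) ∨ e ∈ clF M (insert c₃ R₁))
    (hnd₂ : 3 ≤ rkN M (((G \ coloops M G) \ {w₀, x}).filter (fun e => e ∈ clF M (insert c₂ R₁) ∧ e ∉ clF M R₁)))
    (hdeg₃ : rkN M (((G \ coloops M G) \ {w₀, x}).filter (fun e => e ∈ clF M (insert c₃ R₁) ∧ e ∉ clF M R₁)) ≤ 2)
    {V P W Mset P₃ M' L₀ P₂ Aset Lset : Finset α} (hV : V = (G \ coloops M G) \ {w₀, x})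
    (hP : P = (insert z B \ coloops M G).erase w₀) (hW : W = (G \ insert z B).erase x)
    (hMset : Mset = V.filter (fun e => e ∈ clF M (insert c₃ R₁) ∧ e ∉ clF M R₁))
    (hP₃ : P₃ = P.filter (fun e => e ∈ Mset)) (hM' : M' = W.filter (fun e => e ∈ Mset))
    (hL₀ : L₀ = P.filter (fun e => e ∈ clF M R₁))
    (hP₂ : P₂ = P.filter (fun e => e ∈ clF M (insert c₂ R₁) ∧ e ∉ clF M R₁))
    (hAset : Aset = V.filter (fun e => e ∈ clF M (insert c₂ R₁) ∧ e ∉ clF M R₁))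
    (hLset : Lset = V.filter (fun e => e ∈ clF M R₁)) (hVg : V ⊆ gr M) (hPV : P ⊆ V) (hWV : W ⊆ V)
    (hPW : ∀ e ∈ P, e ∉ W) (hP4 : P.card = 4) (hM3 : 3 ≤ Mset.card) (hM2 : 1 < Mset.card) (hP₃2 : P₃.card ≤ 2)
    (hMsplit : Mset.card = P₃.card + M'.card) (hM'1 : 1 ≤ M'.card) (hL₀2 : L₀.card ≤ 2)
    (hπ₂3 : (P.filter (fun e => e ∈ clF M (insert c₂ R₁))).card ≤ 3) (hL₀P₂ : L₀.card + P₂.card ≤ 3)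
    (hsplit : L₀.card + P₂.card + P₃.card = 4) (hL3 : 3 ≤ Lset.card) :
    ∀ f ∈ Aset, f ∈ W → (∀ a ∈ L₀, ∀ c ∈ P₂, a ≠ c → f ∈ clF M {a, c} → rkN M (insert w₀ (insert x {a, c})) ≤ 3 →
      4 ≤ rkN M ({a, c} ∪ Mset)) → (∀ c ∈ P₂, ∀ c' ∈ P₂, c ≠ c' → f ∈ clF M {c, c'} → rkN M (insert w₀ (insert x {c,
      c'})) ≤ 3 → 4 ≤ rkN M ({c, c'} ∪ Mset)) → f ∉ clF M Mset ∧ ∀ a ∈ P, ∀ b ∈ P, a ≠ b → f ∈ clF M {a, b} → rkN M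
      (insert w₀ (insert x {a, b})) ≤ 3 → 4 ≤ rkN M ({a, b} ∪ Mset) := by
  subst hV hP hW hMset hP₃ hM' hL₀ hP₂ hAset hLset
  set V := (G \ coloops M G) \ {w₀, x} with hV
  set P := (insert z B \ coloops M G).erase w₀ with hP
  set W := (G \ insert z B).erase x with hW
  set Mset := V.filter (fun e => e ∈ clF M (insert c₃ R₁) ∧ e ∉ clF M R₁) with hMset
  set P₃ := P.filter (fun e => e ∈ Mset) with hP₃
  set M' := W.filter (fun e => e ∈ Mset) with hM'
  set L₀ := P.filter (fun e => e ∈ clF M R₁) with hL₀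
  set P₂ := P.filter (fun e => e ∈ clF M (insert c₂ R₁) ∧ e ∉ clF M R₁) with hP₂
  set Aset := V.filter (fun e => e ∈ clF M (insert c₂ R₁) ∧ e ∉ clF M R₁) with hAset
  set Lset := V.filter (fun e => e ∈ clF M R₁) with hLset
  have _u := hd
  have _u := hk
  have _u := hfat
  have _u := hR₁2
  have _u := hR₁3
  have _u := hcop
  have _u := hnd₂
  have _u := hdeg₃
  have _u := hP4
  have _u := hM3
  have _u := hM2
  have _u := hP₃2
  have _u := hMsplit
  have _u := hM'1
  have _u := hL₀2
  have _u := hπ₂3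
  have _u := hL₀P₂
  have _u := hsplit
  have _u := hL3
  intro f hf hfW hac hcc
  apply free_of_plane_point hs hVg hR₁V hR₁2 hc₂V hc₃V hc₂ hc₃ hcover hPV hWV hPW (w₀ := w₀) (x := x) hfW
    (Finset.mem_filter.1 hf).2.1 (Finset.mem_filter.1 hf).2.2
  · intro a ha c hc hac' haL hc2 hcL
    exact hac a (Finset.mem_filter.2 ⟨ha, haL⟩) c (Finset.mem_filter.2 ⟨hc, hc2, hcL⟩) hac'
  · intro c hc c' hc' hcc' hc2 hcL hc'2 hc'L
    exact hcc c (Finset.mem_filter.2 ⟨hc, hc2, hcL⟩) c' (Finset.mem_filter.2 ⟨hc', hc'2, hc'L⟩) hcc'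

/-- A point of `π₂` off the spine in `W` is an unloaded singleton under the pencil condition. -/
theorem deg_wit_singA {w₀ x : α} {R₁ : Finset α} {c₂ c₃ : α} {B : Finset α} {z : α} (hd : (gr M \ G).card = 2)
    (hk : kColoops M G = 1) (hs : ∀ e ∈ gr M, ∀ f ∈ gr M, e ≠ f → rkN M {e, f} = 2)
    (hfat : (fatClosures M 5 G 2).card ≤ 1) (hR₁V : R₁ ⊆ (G \ coloops M G) \ {w₀, x}) (hR₁2 : rkN M R₁ = 2)
    (hR₁3 : 3 ≤ R₁.card) (hcop : rkN M (insert w₀ (insert x R₁)) ≤ 3) (hc₂V : c₂ ∈ (G \ coloops M G) \ {w₀, x})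
    (hc₃V : c₃ ∈ (G \ coloops M G) \ {w₀, x}) (hc₂ : c₂ ∉ clF M R₁) (hc₃ : c₃ ∉ clF M (insert c₂ R₁))
    (hcover : ∀ e ∈ (G \ coloops M G) \ {w₀, x}, e ∈ clF M (insert c₂ R₁) ∨ e ∈ clF M (insert c₃ R₁))
    (hnd₂ : 3 ≤ rkN M (((G \ coloops M G) \ {w₀, x}).filter (fun e => e ∈ clF M (insert c₂ R₁) ∧ e ∉ clF M R₁)))
    (hdeg₃ : rkN M (((G \ coloops M G) \ {w₀, x}).filter (fun e => e ∈ clF M (insert c₃ R₁) ∧ e ∉ clF M R₁)) ≤ 2)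
    {V P W Mset P₃ M' L₀ P₂ Aset Lset : Finset α} (hV : V = (G \ coloops M G) \ {w₀, x})
    (hP : P = (insert z B \ coloops M G).erase w₀) (hW : W = (G \ insert z B).erase x)
    (hMset : Mset = V.filter (fun e => e ∈ clF M (insert c₃ R₁) ∧ e ∉ clF M R₁))
    (hP₃ : P₃ = P.filter (fun e => e ∈ Mset)) (hM' : M' = W.filter (fun e => e ∈ Mset))
    (hL₀ : L₀ = P.filter (fun e => e ∈ clF M R₁))
    (hP₂ : P₂ = P.filter (fun e => e ∈ clF M (insert c₂ R₁) ∧ e ∉ clF M R₁))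
    (hAset : Aset = V.filter (fun e => e ∈ clF M (insert c₂ R₁) ∧ e ∉ clF M R₁))
    (hLset : Lset = V.filter (fun e => e ∈ clF M R₁)) (hVg : V ⊆ gr M) (hPV : P ⊆ V) (hWV : W ⊆ V)
    (hPW : ∀ e ∈ P, e ∉ W) (hP4 : P.card = 4) (hM3 : 3 ≤ Mset.card) (hM2 : 1 < Mset.card) (hP₃2 : P₃.card ≤ 2)
    (hMsplit : Mset.card = P₃.card + M'.card) (hM'1 : 1 ≤ M'.card) (hL₀2 : L₀.card ≤ 2)
    (hπ₂3 : (P.filter (fun e => e ∈ clF M (insert c₂ R₁))).card ≤ 3) (hL₀P₂ : L₀.card + P₂.card ≤ 3)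
    (hsplit : L₀.card + P₂.card + P₃.card = 4) (hL3 : 3 ≤ Lset.card) (hA3 : 3 ≤ Aset.card) :
    ∀ f ∈ Aset, f ∈ W → (∀ a ∈ L₀, ∀ c ∈ P₂, a ≠ c → f ∈ clF M {a, c} → rkN M (insert w₀ (insert x {a, c})) ≤ 3) →
      (∀ c ∈ P₂, ∀ c' ∈ P₂, c ≠ c' → f ∈ clF M {c, c'} → rkN M (insert w₀ (insert x {c, c'})) ≤ 3) → ∀ a ∈ P, ∀ b ∈
      P, a ≠ b → f ∈ clF M {a, b} → rkN M (insert w₀ (insert x {a, b})) ≤ 3 := by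
  subst hV hP hW hMset hP₃ hM' hL₀ hP₂ hAset hLset
  set V := (G \ coloops M G) \ {w₀, x} with hV
  set P := (insert z B \ coloops M G).erase w₀ with hP
  set W := (G \ insert z B).erase x with hW
  set Mset := V.filter (fun e => e ∈ clF M (insert c₃ R₁) ∧ e ∉ clF M R₁) with hMset
  set P₃ := P.filter (fun e => e ∈ Mset) with hP₃
  set M' := W.filter (fun e => e ∈ Mset) with hM'
  set L₀ := P.filter (fun e => e ∈ clF M R₁) with hL₀
  set P₂ := P.filter (fun e => e ∈ clF M (insert c₂ R₁) ∧ e ∉ clF M R₁) with hP₂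
  set Aset := V.filter (fun e => e ∈ clF M (insert c₂ R₁) ∧ e ∉ clF M R₁) with hAset
  set Lset := V.filter (fun e => e ∈ clF M R₁) with hLset
  have _u := hd
  have _u := hk
  have _u := hfat
  have _u := hR₁2
  have _u := hR₁3
  have _u := hcop
  have _u := hnd₂
  have _u := hdeg₃
  have _u := hP4
  have _u := hM3
  have _u := hM2
  have _u := hP₃2
  have _u := hMsplit
  have _u := hM'1
  have _u := hL₀2
  have _u := hπ₂3
  have _u := hL₀P₂
  have _u := hsplit
  have _u := hL3
  have _u := hA3
  intro f hf hfW hac hcc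
  apply single_class_of_plane_point hs hVg hR₁V hR₁2 hc₂V hc₃V hc₂ hc₃ hcover hPV hWV hPW (w₀ := w₀) (x := x) hfW
    (Finset.mem_filter.1 hf).2.1 (Finset.mem_filter.1 hf).2.2
  · intro a ha c hc hac' haL hc2 hcL
    exact hac a (Finset.mem_filter.2 ⟨ha, haL⟩) c (Finset.mem_filter.2 ⟨hc, hc2, hcL⟩) hac'
  · intro c hc c' hc' hcc' hc2 hcL hc'2 hc'L
    exact hcc c (Finset.mem_filter.2 ⟨hc, hc2, hcL⟩) c' (Finset.mem_filter.2 ⟨hc', hc'2, hc'L⟩) hcc'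

/-- When the line of `M` is not a class line, a spine basis point on it and a basis point of `π₂` off the spine span no class line through a point of `W`. -/
theorem deg_wit_notcls {w₀ x : α} {R₁ : Finset α} {c₂ c₃ : α} {B : Finset α} {z : α} (hd : (gr M \ G).card = 2)
    (hk : kColoops M G = 1) (hs : ∀ e ∈ gr M, ∀ f ∈ gr M, e ≠ f → rkN M {e, f} = 2)
    (hfat : (fatClosures M 5 G 2).card ≤ 1) (hne : w₀ ≠ x) (hR₁V : R₁ ⊆ (G \ coloops M G) \ {w₀, x})
    (hR₁2 : rkN M R₁ = 2) (hR₁3 : 3 ≤ R₁.card) (hcop : rkN M (insert w₀ (insert x R₁)) ≤ 3)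
    (hnd₂ : 3 ≤ rkN M (((G \ coloops M G) \ {w₀, x}).filter (fun e => e ∈ clF M (insert c₂ R₁) ∧ e ∉ clF M R₁)))
    (hdeg₃ : rkN M (((G \ coloops M G) \ {w₀, x}).filter (fun e => e ∈ clF M (insert c₃ R₁) ∧ e ∉ clF M R₁)) ≤ 2)
    {V P W Mset P₃ M' L₀ P₂ Aset Lset : Finset α} (hV : V = (G \ coloops M G) \ {w₀, x})
    (hP : P = (insert z B \ coloops M G).erase w₀) (hW : W = (G \ insert z B).erase x)
    (hMset : Mset = V.filter (fun e => e ∈ clF M (insert c₃ R₁) ∧ e ∉ clF M R₁))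
    (hP₃ : P₃ = P.filter (fun e => e ∈ Mset)) (hM' : M' = W.filter (fun e => e ∈ Mset))
    (hL₀ : L₀ = P.filter (fun e => e ∈ clF M R₁))
    (hP₂ : P₂ = P.filter (fun e => e ∈ clF M (insert c₂ R₁) ∧ e ∉ clF M R₁))
    (hAset : Aset = V.filter (fun e => e ∈ clF M (insert c₂ R₁) ∧ e ∉ clF M R₁))
    (hLset : Lset = V.filter (fun e => e ∈ clF M R₁)) (hVg : V ⊆ gr M) (hPV : P ⊆ V) (hP4 : P.card = 4)
    (hw₀g : w₀ ∈ gr M) (hxg : x ∈ gr M) (hw₀V : w₀ ∉ clF M V) (hR₁g : R₁ ⊆ gr M) (hMg : Mset ⊆ gr M)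
    (hM3 : 3 ≤ Mset.card) (hM2 : 1 < Mset.card) (hP₃2 : P₃.card ≤ 2) (hMsplit : Mset.card = P₃.card + M'.card)
    (hM'1 : 1 ≤ M'.card) (hL₀2 : L₀.card ≤ 2) (hπ₂3 : (P.filter (fun e => e ∈ clF M (insert c₂ R₁))).card ≤ 3)
    (hL₀P₂ : L₀.card + P₂.card ≤ 3) (hsplit : L₀.card + P₂.card + P₃.card = 4) (hL3 : 3 ≤ Lset.card)
    (hA3 : 3 ≤ Aset.card) :
    (4 ≤ rkN M (insert w₀ (insert x Mset))) → ∀ a ∈ L₀, a ∈ clF M Mset → ∀ c ∈ P₂, ¬ rkN M (insert w₀ (insert x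
      {a, c})) ≤ 3 := by
  subst hV hP hW hMset hP₃ hM' hL₀ hP₂ hAset hLset
  set V := (G \ coloops M G) \ {w₀, x} with hV
  set P := (insert z B \ coloops M G).erase w₀ with hP
  set W := (G \ insert z B).erase x with hW
  set Mset := V.filter (fun e => e ∈ clF M (insert c₃ R₁) ∧ e ∉ clF M R₁) with hMset
  set P₃ := P.filter (fun e => e ∈ Mset) with hP₃
  set M' := W.filter (fun e => e ∈ Mset) with hM'
  set L₀ := P.filter (fun e => e ∈ clF M R₁) with hL₀
  set P₂ := P.filter (fun e => e ∈ clF M (insert c₂ R₁) ∧ e ∉ clF M R₁) with hP₂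
  set Aset := V.filter (fun e => e ∈ clF M (insert c₂ R₁) ∧ e ∉ clF M R₁) with hAset
  set Lset := V.filter (fun e => e ∈ clF M R₁) with hLset
  have _u := hd
  have _u := hk
  have _u := hfat
  have _u := hR₁2
  have _u := hR₁3
  have _u := hcop
  have _u := hnd₂
  have _u := hdeg₃
  have _u := hP4
  have _u := hM3
  have _u := hM2
  have _u := hP₃2
  have _u := hMsplit
  have _u := hM'1
  have _u := hL₀2
  have _u := hπ₂3
  have _u := hL₀P₂
  have _u := hsplit
  have _u := hL3
  have _u := hA3
  intro hM4 a ha haM c hc hcls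
  have haP : a ∈ P := (Finset.mem_filter.1 ha).1
  have haL : a ∈ clF M R₁ := (Finset.mem_filter.1 ha).2
  have hcP : c ∈ P := (Finset.mem_filter.1 hc).1
  have hag : a ∈ gr M := hVg (hPV haP)
  have hcg : c ∈ gr M := hVg (hPV hcP)
  have hac : a ≠ c := by
    rintro rfl
    exact (Finset.mem_filter.1 hc).2.2 haL
  -- `a` lies on the two class lines `R₁` and `{a, c}` which span a plane: a pencil point
  have hR2 : rkN M ({a, c} : Finset α) = 2 := hs a hag c hcg hac
  have hRV' : ({a, c} : Finset α) ⊆ V := Finset.insert_subset (hPV haP) (Finset.singleton_subset_iff.2 (hPV hcP))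
  have hRR : 3 ≤ rkN M (R₁ ∪ {a, c}) := by
    have h1 : insert c R₁ ⊆ R₁ ∪ {a, c} := by
      intro e he
      rw [Finset.mem_insert] at he
      rw [Finset.mem_union, Finset.mem_insert, Finset.mem_singleton]
      rcases he with rfl | he
      · exact Or.inr (Or.inr rfl)
      · exact Or.inl he
    have h2 := rkN_mono (M := M) h1
    rw [rkN_insert_of_notMem_clF hcg (Finset.mem_filter.1 hc).2.2, hR₁2] at h2
    exact h2
  -- `a ∈ R₁`?  `a ∈ clF R₁` only; use the line `{a} ∪ R₁`… we use `R := insert a R₁` (same closure, rank 2)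
  have haR₁ : rkN M (insert a R₁) = 2 := by
    have : insert a R₁ ⊆ clF M R₁ := Finset.insert_subset haL (subset_clF_of_subset_gr hR₁g)
    have h := rkN_mono (M := M) this
    rw [rkN_clF, hR₁2] at h
    have h' := rkN_mono (M := M) (Finset.subset_insert a R₁)
    omega
  have hR₁cls' : rkN M (insert w₀ (insert x (insert a R₁))) ≤ 3 := by
    have hXg : insert w₀ (insert x R₁) ⊆ gr M := Finset.insert_subset hw₀g (Finset.insert_subset hxg hR₁g)
    have : insert w₀ (insert x (insert a R₁)) ⊆ clF M (insert w₀ (insert x R₁)) := by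
      intro e he
      rw [Finset.mem_insert, Finset.mem_insert, Finset.mem_insert] at he
      rcases he with rfl | rfl | rfl | he
      · exact subset_clF_of_subset_gr hXg (Finset.mem_insert_self _ _)
      · exact subset_clF_of_subset_gr hXg (Finset.mem_insert_of_mem (Finset.mem_insert_self _ _))
      · exact clF_mono ((Finset.subset_insert _ _).trans (Finset.subset_insert _ _)) haL
      · exact subset_clF_of_subset_gr hXg (Finset.mem_insert_of_mem (Finset.mem_insert_of_mem he))
    have h := rkN_mono (M := M) this
    rw [rkN_clF] at h
    omega
  have hRR' : 3 ≤ rkN M (insert a R₁ ∪ {a, c}) := by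
    have : R₁ ∪ {a, c} ⊆ insert a R₁ ∪ {a, c} :=
      Finset.union_subset_union (Finset.subset_insert _ _) (Finset.Subset.refl _)
    exact hRR.trans (rkN_mono this)
  have hpenc := pencil_point_of_class_lines hs hVg hw₀g hxg hne hw₀V
    (Finset.insert_subset (hPV haP) hR₁V) hRV' haR₁ hR2 hR₁cls' hcls hRR'
    (Finset.mem_insert_self _ _) (Finset.mem_insert_self _ _)
  -- every line through a pencil point is a class line, in particular the line of `M` (through `a ∈ clF M`)
  have hxin : x ∈ clF M ({a, w₀} : Finset α) := by
    have hawg : ({a, w₀} : Finset α) ⊆ gr M := Finset.insert_subset hag (Finset.singleton_subset_iff.2 hw₀g)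
    have hwxg : ({w₀, x} : Finset α) ⊆ gr M := Finset.insert_subset hw₀g (Finset.singleton_subset_iff.2 hxg)
    have hsub : ({w₀, x} : Finset α) ⊆ clF M ({a, w₀} : Finset α) := by
      -- `a ∈ clF {w₀, x}` gives `clF {a, w₀} = clF {w₀, x}` (both rank 2)
      have h1 : ({a, w₀} : Finset α) ⊆ clF M ({w₀, x} : Finset α) := by
        intro e he
        rw [Finset.mem_insert, Finset.mem_singleton] at he
        rcases he with rfl | rfl
        · exact hpenc
        · exact subset_clF_of_subset_gr hwxg (Finset.mem_insert_self _ _)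
      have haw : a ≠ w₀ := by
        rintro rfl
        exact hw₀V (subset_clF_of_subset_gr hVg (hPV haP))
      have hcl : clF M ({a, w₀} : Finset α) = clF M ({w₀, x} : Finset α) :=
        clF_eq_clF_of_subset_clF_of_rkN_le hwxg h1 (by rw [hs w₀ hw₀g x hxg hne, hs a hag w₀ hw₀g haw])
      rw [hcl]
      exact subset_clF_of_subset_gr hwxg
    exact hsub (Finset.mem_insert_of_mem (Finset.mem_singleton_self _))
  have hMcls : rkN M (insert w₀ (insert x Mset)) ≤ 3 := by
    have hMw₀g : insert w₀ Mset ⊆ gr M := Finset.insert_subset hw₀g hMg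
    have hsub : insert w₀ (insert x Mset) ⊆ clF M (insert w₀ Mset) := by
      intro e he
      rw [Finset.mem_insert, Finset.mem_insert] at he
      rcases he with rfl | rfl | he
      · exact subset_clF_of_subset_gr hMw₀g (Finset.mem_insert_self _ _)
      · -- `x ∈ clF {a, w₀} ⊆ clF (insert w₀ M)` since `a ∈ clF M`
        have h1 : ({a, w₀} : Finset α) ⊆ clF M (insert w₀ Mset) := by
          intro e he
          rw [Finset.mem_insert, Finset.mem_singleton] at he
          rcases he with rfl | rfl
          · exact clF_mono (Finset.subset_insert _ _) haM
          · exact subset_clF_of_subset_gr hMw₀g (Finset.mem_insert_self _ _)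
        exact clF_subset_clF_of_subset_clF h1 hxin
      · exact subset_clF_of_subset_gr hMw₀g (Finset.mem_insert_of_mem he)
    have h := rkN_mono (M := M) hsub
    rw [rkN_clF] at h
    have h2 : rkN M (insert w₀ Mset) ≤ rkN M Mset + 1 := rkN_insert_le_succ _ _
    omega
  omega

end PercRepro.Shadow
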